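import Literature.NumberTheory.GaloisRepresentations.ContinuousRepHomModules
import Literature.NumberTheory.GaloisRepresentations.PresentationGaloisModules
import HarnessLib

/-!
# Objects of `C_Γ = DiscreteRepCat ℤ Γ` as continuous representations on DISCRETE modules, for an ARBITRARY topological
# group `Γ` (the template `PresentationGaloisModules` §1–§2 = `DGMBridge`, re-typed from `Γ_K` to `Γ`), and `C_Γ`-morphisms
# into `Y` as invariants of `Hom_ℤ(X, Y)` (the template `HomDualShaTwoConnecting` §3, re-typed)

Topic `NumberTheory/GaloisRepresentations`; namespace `Literature.NumberTheory.GaloisRepresentations.ContDGMBridge`.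
Definitions with bodies (the synonym `LCarrier X` with its discrete topology — instances on the NEW synonym only —, `lrep`,
`toCRep`, `lmap`, `lmapTo`, `homInvariant`, `homInvariantHom`, `homOfEquivariant`: plumbing) and theorems; no named fact,
no `sorry`.  The proofs are those of chl-p2 g6/g7's `DGMBridge` / `HomDual` (§3 of `HomDualShaTwoConnecting`), which never used
`Γ = Γ_K`; sequel of `ContinuousRepHomModules` (D4a file 0: `ContHomDual.homContRep`, `invariantOfEquivariant`, `mem_invariants_iff`).

WHY.  Brick D4a of the background lane «PT-Ш-S-TC» (crux `stmt-BirchSwinnertonDyer-19032`; design memo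
`HOME/line-x1-p1-w7-g11/D4A-DESIGN-w7g11.md`): the `S`-obstruction map `Ψ_S : Hom_{C_{G_S}}(N₁, C̄_S) → H²(G_S, M^D)` starts
from a `C_{G_S}`-morphism out of the relation lattice `N₁` of the canonical `S`-presentation (door-c4's
`DiscreteRepFreePresentation`, any profinite `Γ`) and reads it as an invariant of the discrete `G_S`-module `Hom_ℤ(N₁, C̄_S)`;
this file provides exactly that dictionary over `Γ := G_S` (and any `Γ`).

* §1 `LCarrier X` (discrete synonym of `X.obj.V`), `lrep`, **`toCRep X : ContinuousRep Γ ℤ (LCarrier X)`**, `toCRep_apply`,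
  `moduleFinite_lcarrier`;
* §2 `lmap` / `lmapTo` (a `C_Γ`-morphism as `→ⁱL`), `exact_apply`, `shortExact_f_injective`, `shortExact_g_surjective`,
  **`isSES_of_shortExact`**, **`isSES_toCRep`** (a short exact `S` in `C_Γ` is a native `IsSES`);
* §3 **`homInvariant`/`homInvariantHom`** (`(X ⟶ Y) →+ Hom_ℤ(X, Y)^Γ`), **`homOfEquivariant`** (and back).

HONEST FRAMING: plumbing; no arithmetic and no case of BSD is proved here.

## References
* J.-P. Serre, *Galois Cohomology* (1997), I §2.1 (discrete modules), I §2.2. [SerreGaloisCohomology1997]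
* J. S. Milne, *Arithmetic Duality Theorems* (2nd ed. 2006), I §0 (0.8), I Lemma 4.13 (proof). [MilneADT2006]
-/

noncomputable section

open CategoryTheory CategoryTheory.Limits
open scoped ContRepresentation

/-! ## §1 Objects of `C_Γ` as continuous representations on discrete modules -/

namespace Literature.NumberTheory.GaloisRepresentations

namespace ContDGMBridge

open Literature.Algebra.Homology Literature.Algebra.Homology.DiscreteRep

variable {Γ : Type} [Group Γ] [TopologicalSpace Γ] [IsTopologicalGroup Γ]

-- On the vectors `X.obj.V` of an object of `Rep ℤ Γ` two `Module ℤ` structures compete (`Rep.hV2` and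
-- `AddCommGroup.toIntModule`); as in door-c4's `DiscreteRepFreePresentation` the representation's own structure is
-- preferred on `X.obj.V`.  The synonym `LCarrier X` only ever carries the canonical structure of its `AddCommGroup`.
attribute [local instance 10000] Rep.hV2

/-- **The carrier of an object of `C_Γ`, to be given the DISCRETE topology** (a type synonym of `X.obj.V`).
[cite: SerreGaloisCohomology1997, I §2.1] -/
def LCarrier (X : DiscreteRepCat ℤ (Γ)) : Type := X.obj.V

variable (X Y Z : DiscreteRepCat ℤ (Γ))

/-- The additive structure of `X.obj.V`. [cite: SerreGaloisCohomology1997, I §2.1] -/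
instance LCarrier.instAddCommGroup : AddCommGroup (LCarrier X) := inferInstanceAs (AddCommGroup X.obj.V)

/-- The discrete topology. [cite: SerreGaloisCohomology1997, I §2.1] -/
instance LCarrier.instTopologicalSpace : TopologicalSpace (LCarrier X) := ⊥

/-- The topology on `LCarrier X` is discrete by definition. [cite: SerreGaloisCohomology1997, I §2.1] -/
instance LCarrier.instDiscreteTopology : DiscreteTopology (LCarrier X) := ⟨rfl⟩

/-- The identification `X.obj.V → LCarrier X` (the identity). [cite: SerreGaloisCohomology1997, I §2.1] -/
def LCarrier.of : X.obj.V →+ LCarrier X := AddMonoidHom.id _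

/-- The identification `LCarrier X → X.obj.V` (the identity). [cite: SerreGaloisCohomology1997, I §2.1] -/
def LCarrier.val : LCarrier X →+ X.obj.V := AddMonoidHom.id _

omit [IsTopologicalGroup Γ] in
/-- `val (of x) = x`. [cite: SerreGaloisCohomology1997, I §2.1] -/
@[simp] theorem LCarrier.val_of (x : X.obj.V) : LCarrier.val X (LCarrier.of X x) = x := rfl

/-- **The `Γ`-action on `LCarrier X`** (the action of `X.obj`, through additive maps, so that the canonical
`ℤ`-module structure of the synonym is the one in play). [cite: SerreGaloisCohomology1997, I §2.1] -/
def lrep : Representation ℤ (Γ) (LCarrier X) where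
  toFun σ := ((LCarrier.of X).comp ((X.obj.ρ σ).toAddMonoidHom.comp (LCarrier.val X))).toIntLinearMap
  map_one' := LinearMap.ext fun x => by
    change LCarrier.of X (X.obj.ρ 1 (LCarrier.val X x)) = x
    rw [map_one]
    rfl
  map_mul' σ τ := LinearMap.ext fun x => by
    change LCarrier.of X (X.obj.ρ (σ * τ) (LCarrier.val X x)) =
      LCarrier.of X (X.obj.ρ σ (LCarrier.val X (LCarrier.of X (X.obj.ρ τ (LCarrier.val X x)))))
    rw [map_mul]
    rfl

omit [IsTopologicalGroup Γ] in
/-- The stabilisers of `lrep X` are those of `X.obj`, hence open. [cite: SerreGaloisCohomology1997, I §2.1] -/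
theorem isOpen_setOf_lrep_apply_eq (x : LCarrier X) : IsOpen {σ : Γ | lrep X σ x = x} :=
  X.property (LCarrier.val X x)

/-- **`X : C_Γ` as a continuous representation of `Γ` on the discrete `LCarrier X`.** [cite: SerreGaloisCohomology1997, I §2.1] -/
def toCRep : ContinuousRep Γ ℤ (LCarrier X) :=
  ContinuousRep.ofStabilizerMemNhdsOne (lrep X) fun x => (isOpen_setOf_lrep_apply_eq X x).mem_nhds (by simp)

/-- Unfolding: `toCRep X σ x = X.obj.ρ σ x`. [cite: SerreGaloisCohomology1997, I §2.1] -/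
@[simp] theorem toCRep_apply (σ : Γ) (x : LCarrier X) :
    toCRep X σ x = LCarrier.of X (X.obj.ρ σ (LCarrier.val X x)) := rfl

omit [IsTopologicalGroup Γ] in
/-- `LCarrier X` is `ℤ`-finite as soon as `X.obj.V` is (for the representation's own `ℤ`-module structure; all `ℤ`-module
structures coincide — the template's `DGMBridge.moduleFinite_toIntModule`). [cite: MilneADT2006, I Lemma 1.9 (proof)] -/
theorem moduleFinite_lcarrier (h : Module.Finite ℤ X.obj.V) : Module.Finite ℤ (LCarrier X) :=
  DGMBridge.moduleFinite_toIntModule (V := LCarrier X) X.obj.hV2 h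

/-! ## §2 Morphisms and short exact sequences -/

/-- The underlying additive map of a `C_Γ`-morphism on the synonyms. [cite: SerreGaloisCohomology1997, I §2.2] -/
def lmapAddHom (u : X ⟶ Y) : LCarrier X →+ LCarrier Y :=
  (LCarrier.of Y).comp (u.hom.hom.toLinearMap.toAddMonoidHom.comp (LCarrier.val X))

omit [IsTopologicalGroup Γ] in
/-- Unfolding. [cite: SerreGaloisCohomology1997, I §2.2] -/
@[simp] theorem lmapAddHom_apply (u : X ⟶ Y) (x : LCarrier X) :
    lmapAddHom X Y u x = LCarrier.of Y (u.hom.hom (LCarrier.val X x)) := rfl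

/-- Equivariance of `lmapAddHom`. [cite: SerreGaloisCohomology1997, I §2.2] -/
theorem lmapAddHom_smul (u : X ⟶ Y) (σ : Γ) (x : LCarrier X) :
    lmapAddHom X Y u (toCRep X σ x) = toCRep Y σ (lmapAddHom X Y u x) := by
  rw [toCRep_apply, toCRep_apply, lmapAddHom_apply, lmapAddHom_apply, LCarrier.val_of, LCarrier.val_of]
  exact congrArg (LCarrier.of Y) (Rep.hom_comm_apply u.hom σ (LCarrier.val X x))

/-- **A `C_Γ`-morphism `u : X ⟶ Y` as a continuous equivariant map `toCRep X →ⁱL toCRep Y`.**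
[cite: SerreGaloisCohomology1997, I §2.2] -/
def lmap (u : X ⟶ Y) : (toCRep X).toContRepresentation →ⁱL (toCRep Y).toContRepresentation where
  toLinearMap := (lmapAddHom X Y u).toIntLinearMap
  cont := continuous_of_discreteTopology
  isIntertwining' σ := by
    refine ContinuousLinearMap.ext fun x => ?_
    simpa [ContinuousRep.toContRepresentation_apply_apply] using lmapAddHom_smul X Y u σ x

/-- Unfolding `lmap`. [cite: SerreGaloisCohomology1997, I §2.2] -/
@[simp] theorem lmap_apply (u : X ⟶ Y) (x : LCarrier X) :
    lmap X Y u x = LCarrier.of Y (u.hom.hom (LCarrier.val X x)) := rfl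

variable {M : Type} [AddCommGroup M] [TopologicalSpace M] [DiscreteTopology M] (ρ : ContinuousRep Γ ℤ M)

/-- The underlying additive map of `u : X ⟶ ofContinuousRep ρ`, valued in the GIVEN module `M`.
[cite: SerreGaloisCohomology1997, I §2.2] -/
def lmapToAddHom (u : X ⟶ ofContinuousRep ρ) : LCarrier X →+ M :=
  (show (ofContinuousRep ρ).obj.V →+ M from AddMonoidHom.id M).comp
    (u.hom.hom.toLinearMap.toAddMonoidHom.comp (LCarrier.val X))

omit [IsTopologicalGroup Γ] in
/-- Unfolding. [cite: SerreGaloisCohomology1997, I §2.2] -/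
@[simp] theorem lmapToAddHom_apply (u : X ⟶ ofContinuousRep ρ) (x : LCarrier X) :
    lmapToAddHom X ρ u x = u.hom.hom (LCarrier.val X x) := rfl

/-- Equivariance of `lmapToAddHom` for the given `ρ`. [cite: SerreGaloisCohomology1997, I §2.2] -/
theorem lmapToAddHom_smul (u : X ⟶ ofContinuousRep ρ) (σ : Γ) (x : LCarrier X) :
    lmapToAddHom X ρ u (toCRep X σ x) = ρ σ (lmapToAddHom X ρ u x) := by
  rw [toCRep_apply, lmapToAddHom_apply, lmapToAddHom_apply, LCarrier.val_of]
  exact Rep.hom_comm_apply u.hom σ (LCarrier.val X x)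

/-- **A `C_Γ`-morphism `u : X ⟶ ofContinuousRep ρ` as a continuous equivariant map `toCRep X →ⁱL ρ`.**
[cite: SerreGaloisCohomology1997, I §2.2] -/
def lmapTo (u : X ⟶ ofContinuousRep ρ) : (toCRep X).toContRepresentation →ⁱL ρ.toContRepresentation where
  toLinearMap := (lmapToAddHom X ρ u).toIntLinearMap
  cont := continuous_of_discreteTopology
  isIntertwining' σ := by
    refine ContinuousLinearMap.ext fun x => ?_
    simpa [ContinuousRep.toContRepresentation_apply_apply] using lmapToAddHom_smul X ρ u σ x

/-- Unfolding `lmapTo`. [cite: SerreGaloisCohomology1997, I §2.2] -/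
@[simp] theorem lmapTo_apply (u : X ⟶ ofContinuousRep ρ) (x : LCarrier X) :
    lmapTo X ρ u x = u.hom.hom (LCarrier.val X x) := rfl

/-- **Elementwise exactness in `C_Γ`**: for an exact `S`, a vector of `S.X₂` killed by `S.g` comes from `S.X₁`
(the inclusion `C_Γ ⥤ Rep ℤ Γ ⥤ Mod_ℤ` is exact and faithful). [cite: SerreGaloisCohomology1997, I §2.2] -/
theorem exact_apply {S : ShortComplex (DiscreteRepCat ℤ (Γ))} (hS : S.Exact)
    (y : S.X₂.obj.V) (hy : S.g.hom.hom y = 0) : ∃ x : S.X₁.obj.V, S.f.hom.hom x = y := by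
  haveI : (ι ℤ (Γ)).PreservesHomology :=
    ⟨fun _ _ f => (isDiscrete ℤ (Γ)).preservesKernels_ι f,
      fun _ _ f => (isDiscrete ℤ (Γ)).preservesCokernels_ι f⟩
  have h := hS
  rw [← ShortComplex.exact_map_iff_of_faithful _ (ι ℤ (Γ)),
    ← ShortComplex.exact_map_iff_of_faithful _ (forget₂ (Rep.{0} ℤ (Γ)) (ModuleCat.{0} ℤ)),
    ShortComplex.moduleCat_exact_iff] at h
  obtain ⟨x, hx⟩ := h y hy
  exact ⟨x, hx⟩

omit [IsTopologicalGroup Γ] in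
/-- For a short exact `S` in `C_Γ`, `S.f` is injective on vectors. [cite: SerreGaloisCohomology1997, I §2.2] -/
theorem shortExact_f_injective {S : ShortComplex (DiscreteRepCat ℤ (Γ))} (hS : S.ShortExact) :
    Function.Injective S.f.hom.hom :=
  (Rep.mono_iff_injective ((ι ℤ (Γ)).map S.f)).1 (by haveI := hS.mono_f; infer_instance)

/-- For a short exact `S` in `C_Γ`, `S.g` is surjective on vectors. [cite: SerreGaloisCohomology1997, I §2.2] -/
theorem shortExact_g_surjective {S : ShortComplex (DiscreteRepCat ℤ (Γ))} (hS : S.ShortExact) :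
    Function.Surjective S.g.hom.hom :=
  (Rep.epi_iff_surjective ((ι ℤ (Γ)).map S.g)).1 (by haveI := hS.epi_g; infer_instance)

omit [IsTopologicalGroup Γ] in
/-- For a complex `S` in `C_Γ`, `S.g (S.f x) = 0` on vectors. [cite: SerreGaloisCohomology1997, I §2.2] -/
theorem shortComplex_g_f_apply (S : ShortComplex (DiscreteRepCat ℤ (Γ))) (x : S.X₁.obj.V) :
    S.g.hom.hom (S.f.hom.hom x) = 0 := by
  change (S.f ≫ S.g).hom.hom x = 0
  rw [S.zero]
  rfl

/-- **A short exact `S` in `C_Γ` whose third object is `ofContinuousRep ρ` is a native short exact sequence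
`toCRep S.X₁ → toCRep S.X₂ → ρ` of discrete `Γ`-modules (`IsSES`).** [cite: SerreGaloisCohomology1997, I §2.1, I §2.2] -/
theorem isSES_of_shortExact {X₁ X₂ : DiscreteRepCat ℤ (Γ)} (f : X₁ ⟶ X₂)
    (g : X₂ ⟶ ofContinuousRep ρ) (w : f ≫ g = 0) (hS : (ShortComplex.mk f g w).ShortExact) :
    IsSES (TopRep.ofHom (lmap X₁ X₂ f) : (toCRep X₁).toTopRep ⟶ (toCRep X₂).toTopRep)
      (TopRep.ofHom (lmapTo X₂ ρ g) : (toCRep X₂).toTopRep ⟶ ρ.toTopRep) where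
  comp_eq_zero := by
    apply TopRep.hom_ext
    rw [TopRep.hom_comp, TopRep.hom_zero]
    exact DFunLike.ext _ _ fun x => shortComplex_g_f_apply (ShortComplex.mk f g w) (LCarrier.val X₁ x)
  injective := fun a b h => shortExact_f_injective hS h
  exact_mid := fun y hy => by
    obtain ⟨x, hx⟩ := exact_apply (S := ShortComplex.mk f g w) hS.exact (LCarrier.val X₂ y) hy
    exact ⟨LCarrier.of X₁ x, hx⟩
  surjective := fun m => by
    obtain ⟨y, hy⟩ := shortExact_g_surjective (S := ShortComplex.mk f g w) hS m
    exact ⟨LCarrier.of X₂ y, hy⟩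

/-- **A short exact `S` in `C_Γ` is a native short exact sequence `toCRep S.X₁ → toCRep S.X₂ → toCRep S.X₃` of discrete `Γ`-modules.**
[cite: SerreGaloisCohomology1997, I §2.1, I §2.2] -/
theorem isSES_toCRep {S : ShortComplex (DiscreteRepCat ℤ (Γ))} (hS : S.ShortExact) :
    IsSES (TopRep.ofHom (lmap S.X₁ S.X₂ S.f) : (toCRep S.X₁).toTopRep ⟶ (toCRep S.X₂).toTopRep)
      (TopRep.ofHom (lmap S.X₂ S.X₃ S.g) : (toCRep S.X₂).toTopRep ⟶ (toCRep S.X₃).toTopRep) where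
  comp_eq_zero := by
    apply TopRep.hom_ext
    rw [TopRep.hom_comp, TopRep.hom_zero]
    exact DFunLike.ext _ _ fun x => congrArg (LCarrier.of S.X₃) (shortComplex_g_f_apply S (LCarrier.val S.X₁ x))
  injective := fun a b h => shortExact_f_injective hS h
  exact_mid := fun y hy => by
    obtain ⟨x, hx⟩ := exact_apply (S := S) hS.exact (LCarrier.val S.X₂ y) hy
    exact ⟨LCarrier.of S.X₁ x, hx⟩
  surjective := fun m => by
    obtain ⟨y, hy⟩ := shortExact_g_surjective (S := S) hS (LCarrier.val S.X₃ m)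
    exact ⟨LCarrier.of S.X₂ y, hy⟩

end ContDGMBridge

end Literature.NumberTheory.GaloisRepresentations

/-! ## §3 `C_Γ`-morphisms into `Y` as invariants of the `Hom`-modules, and back -/

namespace Literature.NumberTheory.GaloisRepresentations

namespace ContDGMBridge

open Literature.Algebra.Homology Literature.Algebra.Homology.DiscreteRep ContHomDual

variable {Γ : Type} [Group Γ] [TopologicalSpace Γ] [IsTopologicalGroup Γ]
variable (X : DiscreteRepCat ℤ Γ) [Module.Finite ℤ (LCarrier X)] (Y : DiscreteRepCat ℤ Γ)

/-- A `C_Γ`-morphism `u : X ⟶ Y` as an invariant of `Hom_ℤ(X, Y)` (on the `toCRep` synonyms).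
[cite: MilneADT2006, I §0 (0.8)] -/
def homInvariant (u : X ⟶ Y) : (homContRep (toCRep X) (toCRep Y)).toTopRep.ρ.invariants :=
  invariantOfEquivariant _ _ (lmap X Y u).toContinuousLinearMap.toLinearMap (fun σ x => lmapAddHom_smul X Y u σ x)

/-- Unfolding `homInvariant`. [cite: MilneADT2006, I §0 (0.8)] -/
@[simp] theorem coe_homInvariant_apply (u : X ⟶ Y) (x : LCarrier X) :
    (show LCarrier X →ₗ[ℤ] LCarrier Y from ((homInvariant X Y u).1 : DiscreteRep.HomCarrier (LCarrier X) (LCarrier Y))) x =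
      LCarrier.of Y (u.hom.hom (LCarrier.val X x)) := rfl

/-- **`u ↦ homInvariant u` is additive.** [cite: MilneADT2006, I §0 (0.8)] -/
def homInvariantHom : (X ⟶ Y) →+ (homContRep (toCRep X) (toCRep Y)).toTopRep.ρ.invariants where
  toFun := homInvariant X Y
  map_zero' := Subtype.ext (LinearMap.ext fun _ => rfl)
  map_add' _ _ := Subtype.ext (LinearMap.ext fun _ => rfl)

/-- Unfolding `homInvariantHom`. [cite: MilneADT2006, I §0 (0.8)] -/
@[simp] theorem homInvariantHom_apply (u : X ⟶ Y) : homInvariantHom X Y u = homInvariant X Y u := rfl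

-- As in the template: while building an intertwining map out of `X.obj.V` the representation's own `Module ℤ` structure
-- `Rep.hV2` must be the preferred one (a structure field made a local instance for this one definition; no library
-- instance is overridden).
attribute [local instance 10000] Rep.hV2 in
/-- **An equivariant additive map `LCarrier X → LCarrier Y` as a `C_Γ`-morphism `X ⟶ Y`** (inverse to `lmap`; the two
`ℤ`-module structures on the vectors agree, `map_intCast_smul`). [cite: SerreGaloisCohomology1997, I §2.1] -/
def homOfEquivariant (w : LCarrier X →+ LCarrier Y) (hw : ∀ (σ : Γ) (x : LCarrier X), w (toCRep X σ x) = toCRep Y σ (w x)) :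
    X ⟶ Y :=
  ObjectProperty.homMk (Rep.ofHom (ρ := X.obj.ρ) (σ := Y.obj.ρ)
    ⟨{ toFun := fun x => LCarrier.val Y (w (LCarrier.of X x))
       map_add' := fun x y => by rw [map_add, map_add, map_add]
       map_smul' := fun c x => map_intCast_smul ((LCarrier.val Y).comp (w.comp (LCarrier.of X))) ℤ ℤ c x },
      fun σ => LinearMap.ext fun x => hw σ (LCarrier.of X x)⟩)

omit [Module.Finite ℤ (LCarrier X)] in
/-- Unfolding `homOfEquivariant` on vectors. [cite: SerreGaloisCohomology1997, I §2.1] -/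
@[simp] theorem homOfEquivariant_hom_apply (w : LCarrier X →+ LCarrier Y)
    (hw : ∀ (σ : Γ) (x : LCarrier X), w (toCRep X σ x) = toCRep Y σ (w x)) (x : X.obj.V) :
    (homOfEquivariant X Y w hw).hom.hom x = LCarrier.val Y (w (LCarrier.of X x)) := rfl

end ContDGMBridge

end Literature.NumberTheory.GaloisRepresentations
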